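import Mathlib.Algebra.Group.Subgroup.Defs
import Mathlib.Algebra.Group.Submonoid.Defs
import Mathlib.Algebra.Group.Pi.Lemmas
import Mathlib.Algebra.Order.Group.Nat
import Mathlib.Algebra.Group.Pi.Basic
import Mathlib.Tactic.Abel
import HarnessLib

/-!
# The Venn law and the atom law for formally exact monomial («toric») complexes — combinatorial core

Cell `pub-hsemireg`, track S4-PUSH corner 1 (s4-search-1 g11), LEMMA RF and LEMMA AT of
`s4push/search-1/PREREG-1-24-ADDENDUM-B.md` / `-ADDENDUM-C.md` (registry S4-PR-70). HONEST FRAMING: pure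
arithmetic on exponent vectors `ι → ℕ` plus additive bookkeeping in an abelian group `Λ` through an additive
map `φ` («class of a monomial») and a submonoid `C` («effective or zero classes»). Nothing here is a statement
about any variety, line bundle or section, and nothing here bears on HC / HC_CM / HC_AV. The geometric input
(FACT E: effective B-classes lie in the closed future cone, which is pointed) is NOT formalised here.

* `venn_two`: two sub-vectors `A, B ≤ E` split as `A = R + A'`, `B = R + B'` with `R + A' + B' ≤ E`
  (`R = A ⊓ B`); `venn_two_class` (LEMMA RF, k = 2, class level): there is `r ∈ C` with `φ A - r`, `φ B - r`
  and `φ E - φ A - φ B + r` all in `C`.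
* `count_additive` (LEMMA AT (iii)): any additive count `ψ` of exponent vectors is additive along equal paths.
* `atom_single` (LEMMA AT (ii)): if `C` is pointed, every prime has a non-zero class, and the class of `e ≠ 0`
  is an ATOM of `C` (its only splittings `u + (c - u)` inside `C` are trivial), then `e` is a single prime.
-/

namespace Summit.Ventures.HSemireg.VennAtomLaws

variable {ι : Type*}

/-- **Venn split of two sub-vectors.** If `A ≤ E` and `B ≤ E` coordinatewise then with `R = A ⊓ B`,
`A' = A - R`, `B' = B - R` one has `A = R + A'`, `B = R + B'` and `R + A' + B' ≤ E`. -/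
theorem venn_two (A B E : ι → ℕ) (hA : A ≤ E) (hB : B ≤ E) :
    ∃ R A' B' : ι → ℕ, A = R + A' ∧ B = R + B' ∧ R + A' + B' ≤ E := by
  refine ⟨A ⊓ B, fun i => A i - min (A i) (B i), fun i => B i - min (A i) (B i), ?_, ?_, ?_⟩
  · funext i
    simp only [Pi.add_apply, Pi.inf_apply]
    rcases le_total (A i) (B i) with h | h
    · rw [min_eq_left h]; omega
    · rw [min_eq_right h]; omega
  · funext i
    simp only [Pi.add_apply, Pi.inf_apply]
    rcases le_total (A i) (B i) with h | h
    · rw [min_eq_left h]; omega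
    · rw [min_eq_right h]; omega
  · intro i
    have hAi : A i ≤ E i := hA i
    have hBi : B i ≤ E i := hB i
    show min (A i) (B i) + (A i - min (A i) (B i)) + (B i - min (A i) (B i)) ≤ E i
    rcases le_total (A i) (B i) with h | h
    · rw [min_eq_left h]; omega
    · rw [min_eq_right h]; omega

/-- **LEMMA RF (Venn law, k = 2, class level).** Let `φ` send exponent vectors additively to classes in an
abelian group `Λ`, with every `φ x` in the submonoid `C`. If `A, B ≤ E` then there is `r ∈ C` with
`φ A - r ∈ C`, `φ B - r ∈ C` and `φ E - φ A - φ B + r ∈ C`. -/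
theorem venn_two_class {Λ : Type*} [AddCommGroup Λ] (φ : (ι → ℕ) →+ Λ) (C : AddSubmonoid Λ)
    (hC : ∀ x, φ x ∈ C) (A B E : ι → ℕ) (hA : A ≤ E) (hB : B ≤ E) :
    ∃ r ∈ C, φ A - r ∈ C ∧ φ B - r ∈ C ∧ φ E - φ A - φ B + r ∈ C := by
  obtain ⟨R, A', B', h1, h2, h3⟩ := venn_two A B E hA hB
  obtain ⟨Q, hQ⟩ : ∃ Q : ι → ℕ, E = R + A' + B' + Q :=
    ⟨fun i => E i - (R + A' + B') i, by
      funext i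
      have := h3 i
      simp only [Pi.add_apply] at this ⊢
      omega⟩
  refine ⟨φ R, hC R, ?_, ?_, ?_⟩
  · rw [h1, map_add, add_sub_cancel_left]; exact hC A'
  · rw [h2, map_add, add_sub_cancel_left]; exact hC B'
  · rw [hQ, h1, h2]
    simp only [map_add]
    have : φ R + φ A' + φ B' + φ Q - (φ R + φ A') - (φ R + φ B') + φ R = φ Q := by abel
    rw [this]; exact hC Q

/-- **LEMMA AT (iii): counts are additive along equal paths.** For any additive count `ψ` (e.g. the number of
primes of a fixed class), `e₁ + f₁ = e₂ + f₂` gives `ψ e₁ + ψ f₁ = ψ e₂ + ψ f₂`. -/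
theorem count_additive {M : Type*} [AddCommMonoid M] (ψ : (ι → ℕ) →+ M) (e₁ e₂ f₁ f₂ : ι → ℕ)
    (h : e₁ + f₁ = e₂ + f₂) : ψ e₁ + ψ f₁ = ψ e₂ + ψ f₂ := by
  rw [← map_add, ← map_add, h]

variable [DecidableEq ι]

/-- Splitting off one prime: if `e i ≠ 0` then `e = Pi.single i 1 + e'` for some `e'`. -/
theorem exists_single_add (e : ι → ℕ) (i : ι) (hi : e i ≠ 0) :
    ∃ e' : ι → ℕ, e = Pi.single i 1 + e' := by
  refine ⟨e - Pi.single i 1, ?_⟩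
  funext j
  by_cases hj : j = i
  · subst hj
    simp only [Pi.add_apply, Pi.sub_apply, Pi.single_eq_same]
    omega
  · simp only [Pi.add_apply, Pi.sub_apply, Pi.single_eq_of_ne hj]
    omega

/-- In a pointed submonoid a non-zero exponent vector has a non-zero class as soon as every prime does. -/
theorem class_ne_zero {Λ : Type*} [AddCommGroup Λ] (φ : (ι → ℕ) →+ Λ) (C : AddSubmonoid Λ)
    (hC : ∀ x, φ x ∈ C) (hpt : ∀ u, u ∈ C → -u ∈ C → u = 0)
    (hprime : ∀ i, φ (Pi.single i 1) ≠ 0) (e : ι → ℕ) (he : e ≠ 0) : φ e ≠ 0 := by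
  obtain ⟨j, hj⟩ : ∃ j, e j ≠ 0 := Function.ne_iff.mp he
  obtain ⟨e', he'⟩ := exists_single_add e j hj
  intro h0
  rw [he', map_add] at h0
  have hneg : -φ (Pi.single j 1) = φ e' := by
    rw [neg_eq_iff_add_eq_zero, add_comm]
    rw [add_comm] at h0
    exact h0
  have : φ (Pi.single j 1) = 0 := hpt _ (hC _) (by rw [hneg]; exact hC e')
  exact hprime j this

/-- **LEMMA AT (ii): an arc whose class is an atom carries exactly one prime.** Let `C` be pointed
(`u ∈ C`, `-u ∈ C` force `u = 0`), every prime class `φ (Pi.single i 1)` non-zero, every `φ x ∈ C`. If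
`e ≠ 0` and its class `c = φ e` is an ATOM — whenever `u ∈ C` and `c - u ∈ C` then `u = 0` or `u = c` — then
`e = Pi.single i 1` for some `i`. -/
theorem atom_single {Λ : Type*} [AddCommGroup Λ] (φ : (ι → ℕ) →+ Λ) (C : AddSubmonoid Λ)
    (hC : ∀ x, φ x ∈ C) (hpt : ∀ u, u ∈ C → -u ∈ C → u = 0)
    (hprime : ∀ i, φ (Pi.single i 1) ≠ 0) (e : ι → ℕ) (he : e ≠ 0)
    (hatom : ∀ u, u ∈ C → φ e - u ∈ C → u = 0 ∨ u = φ e) :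
    ∃ i, e = Pi.single i 1 := by
  obtain ⟨i, hi⟩ : ∃ i, e i ≠ 0 := Function.ne_iff.mp he
  obtain ⟨e', he'⟩ := exists_single_add e i hi
  refine ⟨i, ?_⟩
  have hsplit : φ e - φ (Pi.single i 1) = φ e' := by rw [he', map_add, add_sub_cancel_left]
  rcases hatom (φ (Pi.single i 1)) (hC _) (by rw [hsplit]; exact hC e') with h0 | h1
  · exact absurd h0 (hprime i)
  · -- then `φ e' = 0`, so `e' = 0` by pointedness
    have hz : φ e' = 0 := by rw [← hsplit, ← h1, sub_self]
    by_cases he'0 : e' = 0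
    · rw [he', he'0, add_zero]
    · exact absurd hz (class_ne_zero φ C hC hpt hprime e' he'0)

end Summit.Ventures.HSemireg.VennAtomLaws
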